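import Literature.Probability.Percolation.SlabUniqueness
import Literature.Probability.Percolation.SlabGluingFact1
import Literature.Probability.Percolation.SlabGluingSurgery
import HarnessLib

/-!
# Critical bond percolation on slabs (DST 2016, Thm. 1): the assembled reduction to Fact 2

Topic: `Literature/Probability/Percolation`. This file only assembles the five files of the
bottom-up decomposition of the named fact `DuminilCopinSidoraviciusTassion2016` (`HalfSpace.lean`;
Duminil-Copin–Sidoravicius–Tassion 2016, Thm. 1: for every `k > 0`, bond percolation on the slab
`S_k = ℤ² × {0,…,k}` has no infinite cluster at its critical point):

* `SlabCriticality.lean` — §2.1: the finite-size criterion, Lemmata 4–5 (proved), eqs. (10)–(13),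
  Thm. 1 from eq. (1), Lemma 6 and the renormalisation step;
* `SlabCriticalityInputs.lean` — §2.2: the renormalisation step and its dependent-percolation
  input (Liggett–Schonmann–Stacey / Peierls) proved; eq. (1) proved from the uniqueness of the
  infinite cluster;
* `SlabUniqueness.lean` — uniqueness of the infinite cluster on slabs proved (Burton–Keane in the
  cut-ball form of Bollobás–Riordan), whence `DuminilCopinSidoraviciusTassion2016.of_lemma6`;
* `SlabGluing.lean` — §2.3: `γ_min`, `U(ω)`, the planar crossing fact (proved), Lemma 6 from
  Facts 1 and 2 (`DuminilCopinSidoraviciusTassion2016_lemma6_of_facts`); Lemma 7 is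
  `MultiValuedMapPrinciple.lean`;
* `SlabGluingFact1.lean` — Fact 1 proved (`DuminilCopinSidoraviciusTassion2016_fact1_holds`).

Hence **DST 2016, Thm. 1 follows from the single named fact
`DuminilCopinSidoraviciusTassion2016_fact2`** (DST 2016, §2.3, Fact 2, pp. 6–7: the local surgery
`ω ↦ {ω^{(z)}, z ∈ U(ω)}` and the multi-valued map principle), which is the only statement of the
paper and of its imported inputs (uniqueness [AKN87, BK89], dependent percolation [LSS97, BBW05])
left as a named fact: `DuminilCopinSidoraviciusTassion2016.of_fact2`.

## What remains: Fact 2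

`DuminilCopinSidoraviciusTassion2016_fact2` (`SlabGluing.lean`) is DST's Fact 2 as printed
(`P[𝒳 ∩ {|U| ≥ t}] ≤ (K/t) · P[C]`), for the vertex-lexicographic `γ_min` and the set `U(ω)` of
that file. Its printed proof (DST 2016, pp. 6–7; Newman–Tassion–Wu 2017, proof of Thm. 3.9) maps
`ω` to the configurations `ω^{(z)}`, `z ∈ U(ω)`, obtained by clearing the ball
`\overline{B_{R+1}(z)}`, rerouting `γ_min(ω)` through `z` (branches `γ_u`, `γ_v` from the first
entry `u'` and to the last exit `v'` of `γ_min(ω)` in `\overline{B_R(z)}`) and attaching a branch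
`γ_w` towards `S̄'_n`, and recovers `z` from `ω^{(z)}` as the unique vertex of `γ_min(ω^{(z)})`
joined to `S̄'_n` off `γ_min(ω^{(z)})`, whence Lemma 7 applies with `s = |edges of the ball|`.
Ingredients still to be formalised: (i) a routing lemma in the slab ball (three disjoint paths
from three neighbours of the centre to three prescribed boundary vertices, with the side
conditions near `S_{3n}`, `Z_n` and the boundary of `B_{3n} ∪ B'_n`); (ii) the recovery of `z`
and the bookkeeping for `lemma7_bond` (`SlabGluingFact1.lean`). The exchange argument showing
that `γ_min(ω^{(z)})` coincides with `γ_min(ω)` up to `u'` and is then forced through `γ_u`, `z`,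
`v` is proved in generic form (`minPath_prefix_of_surgery`, `SlabGluingSurgery.lean`, next to
`minPath_eq_of_surgery` for the variant where `γ_min(ω)` is kept and a branch is attached); only
this prefix statement and the recovery of `z` are needed — the printed remark that the two
minimal paths also coincide "from `v'` up to the end" is not used (and need not hold when
`γ_min(ω)` leaves and re-enters the ball between `u'` and `v'`).

## Sources

* H. Duminil-Copin, V. Sidoravicius, V. Tassion, *Absence of infinite cluster for critical
  Bernoulli percolation on slabs*, Comm. Pure Appl. Math. 69 (2016), 1397–1411,
  arXiv:1401.7130: Thm. 1 (p. 2), Lemma 6 (p. 5), §2.3, Facts 1–2 (pp. 6–7).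
-/

noncomputable section

namespace Literature.Probability.Percolation

/-- PROVED — **DST 2016, Thm. 1 from Fact 2 alone**: the named fact
`DuminilCopinSidoraviciusTassion2016` (`θ_{S_k}(p_c(S_k)) = 0` for every `k > 0`) follows from
`DuminilCopinSidoraviciusTassion2016_fact2` (DST 2016, §2.3, Fact 2), by
`DuminilCopinSidoraviciusTassion2016.of_lemma6` (Thm. 1 ⇐ Lemma 6, with uniqueness, the
renormalisation step, dependent percolation, Lemmata 4–5 and eqs. (1), (10)–(13) proved),
`DuminilCopinSidoraviciusTassion2016_lemma6_of_facts` (Lemma 6 ⇐ Facts 1–2) and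
`DuminilCopinSidoraviciusTassion2016_fact1_holds` (Fact 1).
[cite: DuminilCopinSidoraviciusTassion2016, Thm. 1 and §2.3 (Fact 2)] -/
theorem DuminilCopinSidoraviciusTassion2016.of_fact2
    (h2 : DuminilCopinSidoraviciusTassion2016_fact2) : DuminilCopinSidoraviciusTassion2016 :=
  DuminilCopinSidoraviciusTassion2016.of_lemma6
    (DuminilCopinSidoraviciusTassion2016_lemma6_of_facts
      DuminilCopinSidoraviciusTassion2016_fact1_holds h2)

end Literature.Probability.Percolation
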